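import Summits.QuantumAdvantage.QuantumAdvantage.Theorems.NearExactIsExact.Negative.QuarterSlicingFourteen
import Summits.QuantumAdvantage.QuantumAdvantage.Theorems.NearExactIsExact.Negative.NoConstantResidueFourteen
import Summits.QuantumAdvantage.QuantumAdvantage.Theorems.CubicForrelationNearExactIsExactTenCharacter

/-!
# A case-A type-O cubic on 14 bits has a non-affine digit quadratic
# (THEOREM CA-W, Step 1, rank 0; NearExactIsExact, disprover gen 23)

Negative/structural lemma for the crux `CubicForrelation.NearExactIsExact` (item r2), finite slice `n = 14`;
ONE-SIDED (no partner `f`).  HONEST FRAMING: a theorem about a single cubic Boolean function on 14 bits — the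
"rank 0" exclusion of Step 1 of THEOREM CA-W in affine normal form — NOT summit progress; no violation of
`NearExactIsExact`, no per-`n` value.

Statement (`affine_digit_caseA_false`): let `g` be cubic on `14` bits with `W_g = 32u`, every `u(x)` odd (type O)
and CASE A (`[⌊u/2⌋ odd] ≠ [⌊u/4⌋ odd]` everywhere).  Then the digit `d₁ = [⌊u/2⌋ odd]` is not an AFFINE function
`a ↦ c ⊕ s·a` of the dual variable (written with the character `twist s a = (−1)^{s·a}`:
`d₁(a) ⇔ ((−1)^{s·a} = 1 ⇔ c)`).  The case `s = 0` (constant digit) is the tree lemma `no_caseA_rank_zero`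
(`NoConstantResidueFourteen`); this file reduces the general affine case to it by the translation covariance
`W_{g(·⊕s)}(a) = (−1)^{s·a} W_g(a)` (`ad_W_translate`): the translate `g(·⊕s)` is again cubic, type O, case A, and
its digit is `d₁ ⊕ s·a = c`, constant.

Together with `CaseAWindowFourteen.caseA_window_false` (rank 2) and `RankFourNotCaseAFourteen.rank_four_caseA_false`
(rank ≥ 4) this is the third normal form of THEOREM CA-W; what is NOT formalised is the reduction of an arbitrary
quadratic `d₁` to one of the three normal forms (Dickson's theorem plus the `GL(14,2)` / dual-translation covariance).

Sources: translation covariance of the Walsh transform [cite ODonnell2014 §1.4] (via `twist_bxor_left`, `tc_twist_cases`); the rest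
[this work] / [folklore].  Standard axioms only.
-/

set_option linter.dupNamespace false -- D-0017: single-problem summit ⇒ `QuantumAdvantage.QuantumAdvantage` by design

noncomputable section

namespace Summit.QuantumAdvantage.QuantumAdvantage.Theorems.NearExactIsExact.Negative.AffineDigitCaseAFourteen

open Finset
open Literature.Computability.QuantumComplexity
open Literature.Computability.QuantumComplexity.BuzetChailloux (bxor bxorPerm)
open Literature.Computability.QuantumComplexity.DerivativeWalsh (W twist_bxor_left)
open Summit.QuantumAdvantage.QuantumAdvantage.Theorems.CubicForrelation.NearExactIsExact
open Summit.QuantumAdvantage.QuantumAdvantage.Theorems.NearExactIsExact.Negative.QuarterSlicingFourteen (qs_residue)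
open Summit.QuantumAdvantage.QuantumAdvantage.Theorems.NearExactIsExact.Negative.NoConstantResidueFourteen
  (no_caseA_rank_zero)

/-- Translation preserves algebraic degree: `deg g(· ⊕ s) ≤ deg g`. [folklore] -/
theorem ad_translate_isDegLeFun {n d : ℕ} (g : (Fin n → Bool) → Bool) (hg : IsDegLeFun d g) (s : Fin n → Bool) :
    IsDegLeFun d (fun x => g (bxor x s)) := by
  refine fc_isDegLeFun_comp (D := 1) hg (fun x => bxor x s) (fun v => ?_) (by omega)
  show IsDegLeFun 1 (fun x => x v ^^ s v)
  exact fc_deg_bxor (isDegLeFun_apply v le_rfl) (isDegLeFun_const 1 (s v))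

/-- **Translation covariance of the Walsh transform**: `W_{g(·⊕s)}(a) = (−1)^{s·a} · W_g(a)`.
[cite ODonnell2014 §1.4] [folklore] -/
theorem ad_W_translate {n : ℕ} (g : (Fin n → Bool) → Bool) (s a : Fin n → Bool) :
    W (fun y => signOf (g (bxor y s))) a = twist s a * W (fun y => signOf (g y)) a := by
  unfold W
  have hcomm : ∀ y : Fin n → Bool, bxor y s = bxor s y := fun y => funext fun i => Bool.xor_comm _ _
  simp_rw [hcomm]
  have hre : ∑ y, signOf (g y) * twist y a = ∑ y, signOf (g (bxor s y)) * twist (bxor s y) a :=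
    (Equiv.sum_comp (bxorPerm s) (fun y => signOf (g y) * twist y a)).symm
  rw [hre, mul_sum]
  refine sum_congr rfl fun y _ => ?_
  rw [twist_bxor_left]
  rcases tc_twist_cases s a with h | h
  · rw [h]; ring
  · rw [h]; ring

/-- **THEOREM CA-W, Step 1, rank 0 (affine digit is not case A).** For a cubic `g` on `14` bits with `W_g = 32u`,
all `u(x)` odd and `[⌊u/2⌋ odd] ≠ [⌊u/4⌋ odd]` everywhere, the digit `[⌊u/2⌋ odd]` is not an affine function
`c ⊕ s·a` of the dual variable.  ONE-SIDED; NOT summit progress. [this work] -/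
theorem affine_digit_caseA_false (g : (Fin (7 + 7) → Bool) → Bool) (hg : IsDegLeFun 3 g)
    (u : (Fin (7 + 7) → Bool) → ℤ) (hu : ∀ x, W (fun y => signOf (g y)) x = (2 : ℝ) ^ 5 * (u x : ℝ))
    (hodd : ∀ x, Odd (u x)) (hA : ∀ x, ¬ (Odd (u x / 2) ↔ Odd (u x / 2 / 2)))
    (s : Fin (7 + 7) → Bool) (c : Bool) (hd1 : ∀ a, Odd (u a / 2) ↔ (twist s a = 1 ↔ c = true)) :
    False := by
  classical
  -- the translate g(· ⊕ s) is cubic with normalised spectrum u' = (−1)^{s·a} u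
  have hg' : IsDegLeFun 3 (fun x => g (bxor x s)) := ad_translate_isDegLeFun g hg s
  have hu' : ∀ a, W (fun y => signOf (g (bxor y s))) a =
      (2 : ℝ) ^ 5 * ((if twist s a = 1 then u a else -u a : ℤ) : ℝ) := by
    intro a
    rw [ad_W_translate, hu a]
    rcases tc_twist_cases s a with h | h
    · rw [if_pos h, h, one_mul]
    · rw [if_neg (by rw [h]; norm_num), h]
      push_cast
      ring
  -- its digit is the constant c, so its residue mod 8 is constant: excluded by `no_caseA_rank_zero`
  obtain ⟨h5, h3⟩ := no_caseA_rank_zero (fun x => g (bxor x s)) (fun a => if twist s a = 1 then u a else -u a) hg' hu'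
  have hres : ∀ a, (if twist s a = 1 then u a else -u a) % 8 = (if c = true then 3 else 5 : ℤ) := by
    intro a
    have hr := qs_residue (u a) (hodd a) (hA a)
    have hd := hd1 a
    rcases tc_twist_cases s a with h | h
    · rw [if_pos h]
      rw [h] at hd
      cases c
      · have hno : ¬ Odd (u a / 2) := fun ho => Bool.noConfusion ((hd.1 ho).1 rfl)
        rw [if_neg (by decide)]
        exact hr.2 hno
      · rw [if_pos rfl]
        exact hr.1 (hd.2 (iff_of_true rfl rfl))
    · rw [if_neg (by rw [h]; norm_num)]
      rw [h] at hd
      cases c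
      · have ho : Odd (u a / 2) := hd.2 (iff_of_false (by norm_num) (by decide))
        have h3' := hr.1 ho
        rw [if_neg (by decide)]
        omega
      · have hno : ¬ Odd (u a / 2) := fun ho => absurd ((hd.1 ho).2 rfl) (by norm_num)
        have h5' := hr.2 hno
        rw [if_pos rfl]
        omega
  cases c
  · exact h5 fun a => by rw [hres a, if_neg (by decide)]
  · exact h3 fun a => by rw [hres a, if_pos rfl]

end Summit.QuantumAdvantage.QuantumAdvantage.Theorems.NearExactIsExact.Negative.AffineDigitCaseAFourteen

end
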